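import Summits.ABC.IUTFork.Conditional.AbcOfSGenuineKChosenDepthRadRows3
import Summits.ABC.IUTFork.Conditional.AbcOfSGenuineKLinUniformRows2
import Summits.ABC.IUTFork.Conditional.AbcOfSGenuineKTameRobustRows3
import Summits.ABC.IUTFork.Conditional.AbcOfSGenuineMLinUniformHarvest1
import HarnessLib

/-!
# M LINE: R-W N3 rows DECIDED (refuted side, S_H level at the M-level sharp setting) UNCONDITIONALLY by the local-type-uniform [LIN] test — HARVEST part 10
# (3 known abc triples, 146 (triple, l) pairs of HOME/plan/rescue/R-W/TE30-CENSUS.tsv v2)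

PROOF-ONLY file (no `def`, no new `Prop`, no instance) of the abc-iut cell (W6 prover seat abc-iut-w6-d108, gen 5; R-W lane P−/U row
«W:LINU-HARVEST» = abc-iut-rw-num-lead's LIN-UNIFORM HARVEST LIST, HOME/STATUS 2026-08-26T20:16:17Z: «your e-free decider p464182 fires on 1,907 of the
2,158 Szpiro-BAD admissible (known triple, l) pairs of N3 … 1,800 MORE kernel rows available NOW by one 'exact' each — per-row (p, v, B, i₀) in
HOME/plan/rescue/R-W/TE30-CENSUS.tsv v2 4aacf04dd720d649 columns linu/linu_decidable»). TAKES NO SIDE on [IUTchIII] Cor. 3.12 or on any author.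
M TWIN of this seat's K-line files `AbcOfSGenuineKLinUniformHarvest1–8` (p469692 … p469861; same tables). NO new engine: every row is ONE application of
abc-iut-w5-d107's `GenuineM.not_pilotKummerCompatHull_triple_of_linUniform` (`AbcOfSGenuineMLinUniformTriple`, p466242: abc-iut-s2-p8's M-level sharp
setting `settingPrVolSharpM` of the datum's own read-off ideles `tqM`, pinned reading; `u` a finite place of `ℚ` with `p_u ∉ {2, 3, 5, l}`, `p_u^v ∣ abc`,
`30·l < p_u^B·(p_u−1)`, `j = i₀+1 ≤ l⋆` and the same integer test ⇒ ¬S_H at EVERY genuine Θ-volume datum over `(ratPoint (a/c), l)`), packaged through the M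
table master `GenuineM.not_pilotKummerCompatHull_triple_of_linUniform_table` (M part 1): ONE theorem per (triple, pole prime `p`), hypothesis
`l ∈ [l₁, …, l_k]` = every Szpiro-bad admissible `l` of the census at which the test passes, the certificate table `(l, p, v, B, i₀)` copied from the census
and RE-CHECKED in the kernel by `fin_cases` + `norm_num` (and at the desk by an independent third implementation, this seat's work/gen_harvest.py —
rw-num-lead's engines A/B being the first two). The abc-triple lemmas are REUSED BY NAME from abc-iut-w5-d107 / abc-iut-W-ref-2 / abc-iut-w5-d236's rows
files where they exist. Rows of this part: `frey-2^19*367^3+5^17*197*281=13^2*251^6` (71 l); `frey-7^3*29^5*151^2+2^4*5^16*97*919=3^27*13^4` (1 l); `frey-2^7*23^8+19^9*857^2=3^22*13*47^2*263` (74 l).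
HONEST SCOPE as in p466242 / p464182: SHARP reading (Θ-possible-image set constant in `m`, typed (Ind1)/(Ind2) = Dupuy–Hilado families); per-label licence STRONGER
than print; admissibility / Szpiro-badness / (P6) / non-emptiness of the datum type NOT claimed (apex assemblers' inputs, `Conditional.not_hSHwBad_of_refuted`
p465583); «refuted as typed» ≠ «refuted in print»; nothing about the number-level Corollary; typed ≠ proved; instantiated ≠ endorsed.
[cite: Mochizuki2012, IUTchIII Cor. 3.12 Step (xi-f) p. 184; IUTchIV Prop. 1.2 p. 10, Cor. 2.2 (ii) proof p. 44–46] [cite: MochizukiGenEll2010, Thm. 2.1 p. 11]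
[claim: Mochizuki2012, status: disputed] for every IUT sentence quoted.
-/

noncomputable section

open Set Function NumberField IsDedekindDomain

namespace Summit.ABC.IUTFork.Conditional

open Thm311 Thm311.Real Cor312 Cor312Vol Cor312Prov Literature.IUT.LogThetaLattice Literature.IUT.LogVolume
  Literature.IUT.HodgeTheaters Literature.IUT.LogVolume.ThetaData Literature.IUT.LogVolume.Cor22
open Literature.NumberTheory.NumberFields Literature.NumberTheory.GaloisRepresentations.Ultrametric
open Literature.NumberTheory.DiophantineGeometry Literature.NumberTheory.DiophantineGeometry.GenEll Summit.ABC.ABC.Theorems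

/-! ## §1. M-line rows (one theorem per known abc triple and pole prime) -/

/-- **M LINE, R-W N3 ROWS `frey-2^19*367^3+5^17*197*281=13^2*251^6` over `p = 251` — REFUTED side, UNCONDITIONALLY, by the local-type-uniform [LIN] test at the
71 Szpiro-bad admissible primes** `l ∈` {13, 19, 23, 29, 31, 37, 41, 43, 47, 53, 59, 61, 67, 71, 73, 79, 83, 89, 97, 101, 103, 107, 109, 113, 127, 131, 137, 139, 149, 151, 157,
163, 167, 173, 179, 181, 191, 193, 197, 199, 211, 223, 227, 229, 233, 239, 241, 257, 263, 269, 271, 277, 281, 283, 293, 307, 311, 313, 317,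
331, 337, 347, 349, 353, 359, 367, 373, 379, 383, 389, 397} (rows of HOME/plan/rescue/R-W/TE30-CENSUS.tsv v2 with `linu_decidable = Y`; table rows
`(l, p, v, B, i₀)`, j = i₀+1; `p = 251`, `v = 6` (all rows)): for every finite place `u` of `ℚ` with `p_u = 251` and every genuine Θ-volume datum `T` over `(ratPoint (a/c), l)`, the
hull-level clause S_H at the M-level sharp setting of `T`'s own read-off ideles (pinned reading) FAILS for every choice of the free context binders and Kummer
datum (M twin of the K-line `GenuineK.not_pilotKummerCompatHull_chosen_frey25916008300544_linu`). NOT claimed: admissibility / Szpiro-badness / (P6) / non-emptiness.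
[cite: Mochizuki2012, IUTchIII Cor. 3.12 Step (xi-f) p. 184] [claim: Mochizuki2012, status: disputed] -/
theorem GenuineM.not_pilotKummerCompatHull_frey25916008300544_p251_linu {l : ℕ}
    (hl : l ∈ [13, 19, 23, 29, 31, 37, 41, 43, 47, 53, 59, 61, 67, 71, 73, 79, 83, 89, 97, 101, 103, 107, 109, 113, 127, 131, 137, 139, 149, 151, 157,
      163, 167, 173, 179, 181, 191, 193, 197, 199, 211, 223, 227, 229, 233, 239, 241, 257, 263, 269, 271, 277, 281, 283, 293, 307, 311, 313, 317,
      331, 337, 347, 349, 353, 359, 367, 373, 379, 383, 389, 397])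
    (T : Cor22.ThetaVolumeDatumAt (ratPoint (((2 ^ 19 * 367 ^ 3 : ℕ) : ℚ) / (13 ^ 2 * 251 ^ 6 : ℕ))) l) (u : FinitePlace ℚ) (hu : ratChar u = 251) :
    letI := T.instFieldF; letI := T.instNumberFieldF; letI := T.instAlgebraF; letI := T.instFieldK
    letI := T.instNumberFieldK; letI := T.instAlgebraK; letI := T.instFieldFbar; letI := T.instAlgebraFbar
    letI := T.instAlgebraKFbar; letI := T.instIsElliptic
    ∀ (M : Type) [Field M] [NumberField M]
      (archPk : ∀ (j : (thetaIndexOfInitial T.D).Label) (vQ : (thetaIndexOfInitial T.D).VQ),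
        Set ((logShellsOfInitialDH T.D (analyticLogvVal T.K)).Packet j vQ))
      (archSub : ∀ (j : (thetaIndexOfInitial T.D).Label) (v : (thetaIndexOfInitial T.D).V),
        Set ((logShellsOfInitialDH T.D (analyticLogvVal T.K)).Packet j ((thetaIndexOfInitial T.D).over v)))
      (Ψ : ℤ → ∀ v : (thetaIndexOfInitial T.D).V, v ∈ (thetaIndexOfInitial T.D).Vbad →
        Set ((logShellsOfInitialDH T.D (analyticLogvVal T.K)).StarPacket v))
      (act : ℤ → ∀ v : (thetaIndexOfInitial T.D).V, v ∈ (thetaIndexOfInitial T.D).Vbad →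
        (logShellsOfInitialDH T.D (analyticLogvVal T.K)).StarPacket v →
          Module.End ℚ ((logShellsOfInitialDH T.D (analyticLogvVal T.K)).StarPacket v))
      (Mmod : ℤ → ∀ j : (thetaIndexOfInitial T.D).LabelStar, Set ((logShellsOfInitialDH T.D (analyticLogvVal T.K)).GlobalPacket j.1))
      (region : ℤ → ∀ j : (thetaIndexOfInitial T.D).LabelStar, FinDivisor M → ∀ vQ : (thetaIndexOfInitial T.D).VQ,
        Set ((logShellsOfInitialDH T.D (analyticLogvVal T.K)).Packet j.1 vQ))
      (frobAdm : ℤ → ℤ → ∀ (j : (thetaIndexOfInitial T.D).Label) (vQ : (thetaIndexOfInitial T.D).VQ),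
        Set ((logShellsOfInitialDH T.D (analyticLogvVal T.K)).Packet j vQ) → Prop)
      (frobLogvol : ℤ → ℤ → ∀ (j : (thetaIndexOfInitial T.D).Label) (vQ : (thetaIndexOfInitial T.D).VQ),
        Set ((logShellsOfInitialDH T.D (analyticLogvVal T.K)).Packet j vQ) → ℝ)
      (frobΨ : ℤ → ℤ → ∀ v : (thetaIndexOfInitial T.D).V, v ∈ (thetaIndexOfInitial T.D).Vbad →
        Set ((logShellsOfInitialDH T.D (analyticLogvVal T.K)).StarPacket v))
      (frobMmod : ℤ → ℤ → ∀ j : (thetaIndexOfInitial T.D).LabelStar, Set ((logShellsOfInitialDH T.D (analyticLogvVal T.K)).GlobalPacket j.1))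
      (unitImage : ℤ → ℤ → ℕ → ∀ (j : (thetaIndexOfInitial T.D).Label) (vQ : (thetaIndexOfInitial T.D).VQ),
        Set ((logShellsOfInitialDH T.D (analyticLogvVal T.K)).Packet j vQ))
      (ballImage : ℤ → ℤ → ∀ (j : (thetaIndexOfInitial T.D).Label) (vQ : (thetaIndexOfInitial T.D).VQ),
        Set ((logShellsOfInitialDH T.D (analyticLogvVal T.K)).Packet j vQ))
      (thetaDiv : ℤ → ℤ → LgpDivisor M (thetaIndexOfInitial T.D).lstar)
      (n : ℤ) {HT : Type} {LogLink : HT → HT → Type} {IsFull : ∀ {s t : HT}, LogLink s t → Prop}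
      (lat : LGPGaussianLogThetaLattice LogLink IsFull)
      {Frd : Type} {IsoF : Frd → Frd → Type} {Ob : Frd → Type} {realify : Frd → Frd} {Strip : Type}
      {IsoS : Strip → Strip → Type} {Mv : ∀ v : (thetaIndexOfInitial T.D).V, v ∈ (thetaIndexOfInitial T.D).Vbad → Type}
      [∀ v h, Monoid (Mv v h)]
      (sig : GlobalLGPFrobenioidSignature (thetaIndexOfInitial T.D).lstar (thetaIndexOfInitial T.D).V
        (· ∈ (thetaIndexOfInitial T.D).Vbad) Frd IsoF Ob realify Strip IsoS Mv)
      (split : SplittingMonoids Mv) {ObΔ : Type} {N : ∀ v : (thetaIndexOfInitial T.D).V, v ∈ (thetaIndexOfInitial T.D).Vbad → Type}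
      [∀ v h, Monoid (N v h)] (qData : QPilotData ObΔ N)
      (qK : ∀ v : (thetaIndexOfInitial T.D).V, v ∈ (thetaIndexOfInitial T.D).Vbad →
        Set ((logShellsOfInitialDH T.D (analyticLogvVal T.K)).StarPacket v)),
      ¬ Cor312Vol.PilotKummerCompatHull
        (LatticeSituation.ofShells (logShellsOfInitialDH T.D (analyticLogvVal T.K)) M archPk archSub
          (summandPiecesPrM T.D (logvAnalyticVal_analyticLogvVal (K := T.K))).Adm (summandPiecesPrM T.D (logvAnalyticVal_analyticLogvVal (K := T.K))).logvol Ψ act Mmod region frobAdm frobLogvol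
          frobΨ frobMmod unitImage ballImage thetaDiv)
        (settingPrVolSharpM T.D (logvAnalyticVal_analyticLogvVal (K := T.K)) (tOfIdeleData T.D (ideleDataOf T.D T.isVolumeInputOf))
          (fun u x => tqM T.D (ratChar u) u (natCast_ratChar_mem u) (ideleDataOf T.D T.isVolumeInputOf) x) M archPk archSub Ψ act Mmod region n lat sig split qData
          (fun u x => tqM_ne_zero T.D (ratChar u) u (natCast_ratChar_mem u) (ideleDataOf T.D T.isVolumeInputOf) x)
          (GenuineM.finite_ratPlaces_under_S T.D).toFinset
          (fun u x hu => norm_tqM_eq_one_of_not_mem T.D (ratChar u) u (natCast_ratChar_mem u) (ideleDataOf T.D T.isVolumeInputOf) x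
            fun hx => hu ((Set.Finite.mem_toFinset _).mpr ⟨x, hx⟩)))
        (fun _ => Cor312.Setting.qRegion
          (settingPrVolSharpM T.D (logvAnalyticVal_analyticLogvVal (K := T.K)) (tOfIdeleData T.D (ideleDataOf T.D T.isVolumeInputOf))
          (fun u x => tqM T.D (ratChar u) u (natCast_ratChar_mem u) (ideleDataOf T.D T.isVolumeInputOf) x) M archPk archSub Ψ act Mmod region n lat sig split qData
          (fun u x => tqM_ne_zero T.D (ratChar u) u (natCast_ratChar_mem u) (ideleDataOf T.D T.isVolumeInputOf) x)
          (GenuineM.finite_ratPlaces_under_S T.D).toFinset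
          (fun u x hu => norm_tqM_eq_one_of_not_mem T.D (ratChar u) u (natCast_ratChar_mem u) (ideleDataOf T.D T.isVolumeInputOf) x
            fun hx => hu ((Set.Finite.mem_toFinset _).mpr ⟨x, hx⟩)))) qK :=
  GenuineM.not_pilotKummerCompatHull_triple_of_linUniform_table isABCTriple_367251
    [(13, 251, 6, 1, 5), (19, 251, 6, 1, 7), (23, 251, 6, 1, 9), (29, 251, 6, 1, 11), (31, 251, 6, 1, 11), (37, 251, 6, 1, 13),
      (41, 251, 6, 1, 15), (43, 251, 6, 1, 15), (47, 251, 6, 1, 17), (53, 251, 6, 1, 19), (59, 251, 6, 1, 21), (61, 251, 6, 1, 21),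
      (67, 251, 6, 1, 23), (71, 251, 6, 1, 25), (73, 251, 6, 1, 25), (79, 251, 6, 1, 27), (83, 251, 6, 1, 29), (89, 251, 6, 1, 31),
      (97, 251, 6, 1, 33), (101, 251, 6, 1, 35), (103, 251, 6, 1, 35), (107, 251, 6, 1, 37), (109, 251, 6, 1, 37), (113, 251, 6, 1, 39),
      (127, 251, 6, 1, 43), (131, 251, 6, 1, 45), (137, 251, 6, 1, 47), (139, 251, 6, 1, 47), (149, 251, 6, 1, 51), (151, 251, 6, 1, 51),
      (157, 251, 6, 1, 53), (163, 251, 6, 1, 55), (167, 251, 6, 1, 57), (173, 251, 6, 1, 59), (179, 251, 6, 1, 61), (181, 251, 6, 1, 61),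
      (191, 251, 6, 1, 65), (193, 251, 6, 1, 65), (197, 251, 6, 1, 67), (199, 251, 6, 1, 67), (211, 251, 6, 1, 71), (223, 251, 6, 1, 75),
      (227, 251, 6, 1, 77), (229, 251, 6, 1, 77), (233, 251, 6, 1, 79), (239, 251, 6, 1, 81), (241, 251, 6, 1, 81), (257, 251, 6, 1, 87),
      (263, 251, 6, 1, 89), (269, 251, 6, 1, 91), (271, 251, 6, 1, 92), (277, 251, 6, 1, 94), (281, 251, 6, 1, 95), (283, 251, 6, 1, 96),
      (293, 251, 6, 1, 99), (307, 251, 6, 1, 104), (311, 251, 6, 1, 105), (313, 251, 6, 1, 106), (317, 251, 6, 1, 107), (331, 251, 6, 1, 112),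
      (337, 251, 6, 1, 114), (347, 251, 6, 1, 117), (349, 251, 6, 1, 118), (353, 251, 6, 1, 119), (359, 251, 6, 1, 121), (367, 251, 6, 1, 124),
      (373, 251, 6, 1, 126), (379, 251, 6, 1, 128), (383, 251, 6, 1, 129), (389, 251, 6, 1, 131), (397, 251, 6, 1, 134)]
    (by intro r hr; fin_cases hr <;> norm_num) (by simpa using hl) T u hu

/-- **M LINE, R-W N3 ROWS `frey-7^3*29^5*151^2+2^4*5^16*97*919=3^27*13^4` over `p = 29` — REFUTED side, UNCONDITIONALLY, by the local-type-uniform [LIN] test at the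
1 Szpiro-bad admissible primes** `l ∈` {23} (rows of HOME/plan/rescue/R-W/TE30-CENSUS.tsv v2 with `linu_decidable = Y`; table rows
`(l, p, v, B, i₀)`, j = i₀+1; `p = 29`, `v = 5` (all rows)): for every finite place `u` of `ℚ` with `p_u = 29` and every genuine Θ-volume datum `T` over `(ratPoint (a/c), l)`, the
hull-level clause S_H at the M-level sharp setting of `T`'s own read-off ideles (pinned reading) FAILS for every choice of the free context binders and Kummer
datum (M twin of the K-line `GenuineK.not_pilotKummerCompatHull_chosen_frey160412424963707_linu`). NOT claimed: admissibility / Szpiro-badness / (P6) / non-emptiness.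
[cite: Mochizuki2012, IUTchIII Cor. 3.12 Step (xi-f) p. 184] [claim: Mochizuki2012, status: disputed] -/
theorem GenuineM.not_pilotKummerCompatHull_frey160412424963707_p29_linu {l : ℕ}
    (hl : l ∈ [23])
    (T : Cor22.ThetaVolumeDatumAt (ratPoint (((7 ^ 3 * 29 ^ 5 * 151 ^ 2 : ℕ) : ℚ) / (3 ^ 27 * 13 ^ 4 : ℕ))) l) (u : FinitePlace ℚ) (hu : ratChar u = 29) :
    letI := T.instFieldF; letI := T.instNumberFieldF; letI := T.instAlgebraF; letI := T.instFieldK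
    letI := T.instNumberFieldK; letI := T.instAlgebraK; letI := T.instFieldFbar; letI := T.instAlgebraFbar
    letI := T.instAlgebraKFbar; letI := T.instIsElliptic
    ∀ (M : Type) [Field M] [NumberField M]
      (archPk : ∀ (j : (thetaIndexOfInitial T.D).Label) (vQ : (thetaIndexOfInitial T.D).VQ),
        Set ((logShellsOfInitialDH T.D (analyticLogvVal T.K)).Packet j vQ))
      (archSub : ∀ (j : (thetaIndexOfInitial T.D).Label) (v : (thetaIndexOfInitial T.D).V),
        Set ((logShellsOfInitialDH T.D (analyticLogvVal T.K)).Packet j ((thetaIndexOfInitial T.D).over v)))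
      (Ψ : ℤ → ∀ v : (thetaIndexOfInitial T.D).V, v ∈ (thetaIndexOfInitial T.D).Vbad →
        Set ((logShellsOfInitialDH T.D (analyticLogvVal T.K)).StarPacket v))
      (act : ℤ → ∀ v : (thetaIndexOfInitial T.D).V, v ∈ (thetaIndexOfInitial T.D).Vbad →
        (logShellsOfInitialDH T.D (analyticLogvVal T.K)).StarPacket v →
          Module.End ℚ ((logShellsOfInitialDH T.D (analyticLogvVal T.K)).StarPacket v))
      (Mmod : ℤ → ∀ j : (thetaIndexOfInitial T.D).LabelStar, Set ((logShellsOfInitialDH T.D (analyticLogvVal T.K)).GlobalPacket j.1))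
      (region : ℤ → ∀ j : (thetaIndexOfInitial T.D).LabelStar, FinDivisor M → ∀ vQ : (thetaIndexOfInitial T.D).VQ,
        Set ((logShellsOfInitialDH T.D (analyticLogvVal T.K)).Packet j.1 vQ))
      (frobAdm : ℤ → ℤ → ∀ (j : (thetaIndexOfInitial T.D).Label) (vQ : (thetaIndexOfInitial T.D).VQ),
        Set ((logShellsOfInitialDH T.D (analyticLogvVal T.K)).Packet j vQ) → Prop)
      (frobLogvol : ℤ → ℤ → ∀ (j : (thetaIndexOfInitial T.D).Label) (vQ : (thetaIndexOfInitial T.D).VQ),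
        Set ((logShellsOfInitialDH T.D (analyticLogvVal T.K)).Packet j vQ) → ℝ)
      (frobΨ : ℤ → ℤ → ∀ v : (thetaIndexOfInitial T.D).V, v ∈ (thetaIndexOfInitial T.D).Vbad →
        Set ((logShellsOfInitialDH T.D (analyticLogvVal T.K)).StarPacket v))
      (frobMmod : ℤ → ℤ → ∀ j : (thetaIndexOfInitial T.D).LabelStar, Set ((logShellsOfInitialDH T.D (analyticLogvVal T.K)).GlobalPacket j.1))
      (unitImage : ℤ → ℤ → ℕ → ∀ (j : (thetaIndexOfInitial T.D).Label) (vQ : (thetaIndexOfInitial T.D).VQ),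
        Set ((logShellsOfInitialDH T.D (analyticLogvVal T.K)).Packet j vQ))
      (ballImage : ℤ → ℤ → ∀ (j : (thetaIndexOfInitial T.D).Label) (vQ : (thetaIndexOfInitial T.D).VQ),
        Set ((logShellsOfInitialDH T.D (analyticLogvVal T.K)).Packet j vQ))
      (thetaDiv : ℤ → ℤ → LgpDivisor M (thetaIndexOfInitial T.D).lstar)
      (n : ℤ) {HT : Type} {LogLink : HT → HT → Type} {IsFull : ∀ {s t : HT}, LogLink s t → Prop}
      (lat : LGPGaussianLogThetaLattice LogLink IsFull)
      {Frd : Type} {IsoF : Frd → Frd → Type} {Ob : Frd → Type} {realify : Frd → Frd} {Strip : Type}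
      {IsoS : Strip → Strip → Type} {Mv : ∀ v : (thetaIndexOfInitial T.D).V, v ∈ (thetaIndexOfInitial T.D).Vbad → Type}
      [∀ v h, Monoid (Mv v h)]
      (sig : GlobalLGPFrobenioidSignature (thetaIndexOfInitial T.D).lstar (thetaIndexOfInitial T.D).V
        (· ∈ (thetaIndexOfInitial T.D).Vbad) Frd IsoF Ob realify Strip IsoS Mv)
      (split : SplittingMonoids Mv) {ObΔ : Type} {N : ∀ v : (thetaIndexOfInitial T.D).V, v ∈ (thetaIndexOfInitial T.D).Vbad → Type}
      [∀ v h, Monoid (N v h)] (qData : QPilotData ObΔ N)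
      (qK : ∀ v : (thetaIndexOfInitial T.D).V, v ∈ (thetaIndexOfInitial T.D).Vbad →
        Set ((logShellsOfInitialDH T.D (analyticLogvVal T.K)).StarPacket v)),
      ¬ Cor312Vol.PilotKummerCompatHull
        (LatticeSituation.ofShells (logShellsOfInitialDH T.D (analyticLogvVal T.K)) M archPk archSub
          (summandPiecesPrM T.D (logvAnalyticVal_analyticLogvVal (K := T.K))).Adm (summandPiecesPrM T.D (logvAnalyticVal_analyticLogvVal (K := T.K))).logvol Ψ act Mmod region frobAdm frobLogvol
          frobΨ frobMmod unitImage ballImage thetaDiv)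
        (settingPrVolSharpM T.D (logvAnalyticVal_analyticLogvVal (K := T.K)) (tOfIdeleData T.D (ideleDataOf T.D T.isVolumeInputOf))
          (fun u x => tqM T.D (ratChar u) u (natCast_ratChar_mem u) (ideleDataOf T.D T.isVolumeInputOf) x) M archPk archSub Ψ act Mmod region n lat sig split qData
          (fun u x => tqM_ne_zero T.D (ratChar u) u (natCast_ratChar_mem u) (ideleDataOf T.D T.isVolumeInputOf) x)
          (GenuineM.finite_ratPlaces_under_S T.D).toFinset
          (fun u x hu => norm_tqM_eq_one_of_not_mem T.D (ratChar u) u (natCast_ratChar_mem u) (ideleDataOf T.D T.isVolumeInputOf) x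
            fun hx => hu ((Set.Finite.mem_toFinset _).mpr ⟨x, hx⟩)))
        (fun _ => Cor312.Setting.qRegion
          (settingPrVolSharpM T.D (logvAnalyticVal_analyticLogvVal (K := T.K)) (tOfIdeleData T.D (ideleDataOf T.D T.isVolumeInputOf))
          (fun u x => tqM T.D (ratChar u) u (natCast_ratChar_mem u) (ideleDataOf T.D T.isVolumeInputOf) x) M archPk archSub Ψ act Mmod region n lat sig split qData
          (fun u x => tqM_ne_zero T.D (ratChar u) u (natCast_ratChar_mem u) (ideleDataOf T.D T.isVolumeInputOf) x)
          (GenuineM.finite_ratPlaces_under_S T.D).toFinset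
          (fun u x hu => norm_tqM_eq_one_of_not_mem T.D (ratChar u) u (natCast_ratChar_mem u) (ideleDataOf T.D T.isVolumeInputOf) x
            fun hx => hu ((Set.Finite.mem_toFinset _).mpr ⟨x, hx⟩)))) qK :=
  GenuineM.not_pilotKummerCompatHull_triple_of_linUniform_table isABCTriple_frey160412424963707
    [(23, 29, 5, 1, 10)]
    (by intro r hr; fin_cases hr; norm_num) (by simpa using hl) T u hu

/-- **M LINE, R-W N3 ROWS `frey-2^7*23^8+19^9*857^2=3^22*13*47^2*263` over `p = 19` — REFUTED side, UNCONDITIONALLY, by the local-type-uniform [LIN] test at the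
73 Szpiro-bad admissible primes** `l ∈` {7, 13, 17, 23, 29, 31, 37, 41, 43, 47, 53, 59, 61, 67, 71, 73, 79, 83, 89, 97, 101, 103, 107, 109, 113, 127, 131, 137, 139, 149, 151, 157,
163, 167, 173, 179, 181, 191, 193, 197, 199, 211, 223, 227, 229, 233, 239, 241, 251, 257, 263, 269, 271, 277, 281, 283, 293, 307, 311, 313,
317, 331, 337, 347, 349, 353, 359, 367, 373, 379, 383, 389, 397} (rows of HOME/plan/rescue/R-W/TE30-CENSUS.tsv v2 with `linu_decidable = Y`; table rows
`(l, p, v, B, i₀)`, j = i₀+1; `p = 19`, `v = 9` (all rows)): for every finite place `u` of `ℚ` with `p_u = 19` and every genuine Θ-volume datum `T` over `(ratPoint (a/c), l)`, the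
hull-level clause S_H at the M-level sharp setting of `T`'s own read-off ideles (pinned reading) FAILS for every choice of the free context binders and Kummer
datum (M twin of the K-line `GenuineK.not_pilotKummerCompatHull_chosen_frey10023806115968_linu`). NOT claimed: admissibility / Szpiro-badness / (P6) / non-emptiness.
[cite: Mochizuki2012, IUTchIII Cor. 3.12 Step (xi-f) p. 184] [claim: Mochizuki2012, status: disputed] -/
theorem GenuineM.not_pilotKummerCompatHull_frey10023806115968_p19_linu {l : ℕ}
    (hl : l ∈ [7, 13, 17, 23, 29, 31, 37, 41, 43, 47, 53, 59, 61, 67, 71, 73, 79, 83, 89, 97, 101, 103, 107, 109, 113, 127, 131, 137, 139, 149, 151, 157,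
      163, 167, 173, 179, 181, 191, 193, 197, 199, 211, 223, 227, 229, 233, 239, 241, 251, 257, 263, 269, 271, 277, 281, 283, 293, 307, 311, 313,
      317, 331, 337, 347, 349, 353, 359, 367, 373, 379, 383, 389, 397])
    (T : Cor22.ThetaVolumeDatumAt (ratPoint (((2 ^ 7 * 23 ^ 8 : ℕ) : ℚ) / (3 ^ 22 * 13 * 47 ^ 2 * 263 : ℕ))) l) (u : FinitePlace ℚ) (hu : ratChar u = 19) :
    letI := T.instFieldF; letI := T.instNumberFieldF; letI := T.instAlgebraF; letI := T.instFieldK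
    letI := T.instNumberFieldK; letI := T.instAlgebraK; letI := T.instFieldFbar; letI := T.instAlgebraFbar
    letI := T.instAlgebraKFbar; letI := T.instIsElliptic
    ∀ (M : Type) [Field M] [NumberField M]
      (archPk : ∀ (j : (thetaIndexOfInitial T.D).Label) (vQ : (thetaIndexOfInitial T.D).VQ),
        Set ((logShellsOfInitialDH T.D (analyticLogvVal T.K)).Packet j vQ))
      (archSub : ∀ (j : (thetaIndexOfInitial T.D).Label) (v : (thetaIndexOfInitial T.D).V),
        Set ((logShellsOfInitialDH T.D (analyticLogvVal T.K)).Packet j ((thetaIndexOfInitial T.D).over v)))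
      (Ψ : ℤ → ∀ v : (thetaIndexOfInitial T.D).V, v ∈ (thetaIndexOfInitial T.D).Vbad →
        Set ((logShellsOfInitialDH T.D (analyticLogvVal T.K)).StarPacket v))
      (act : ℤ → ∀ v : (thetaIndexOfInitial T.D).V, v ∈ (thetaIndexOfInitial T.D).Vbad →
        (logShellsOfInitialDH T.D (analyticLogvVal T.K)).StarPacket v →
          Module.End ℚ ((logShellsOfInitialDH T.D (analyticLogvVal T.K)).StarPacket v))
      (Mmod : ℤ → ∀ j : (thetaIndexOfInitial T.D).LabelStar, Set ((logShellsOfInitialDH T.D (analyticLogvVal T.K)).GlobalPacket j.1))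
      (region : ℤ → ∀ j : (thetaIndexOfInitial T.D).LabelStar, FinDivisor M → ∀ vQ : (thetaIndexOfInitial T.D).VQ,
        Set ((logShellsOfInitialDH T.D (analyticLogvVal T.K)).Packet j.1 vQ))
      (frobAdm : ℤ → ℤ → ∀ (j : (thetaIndexOfInitial T.D).Label) (vQ : (thetaIndexOfInitial T.D).VQ),
        Set ((logShellsOfInitialDH T.D (analyticLogvVal T.K)).Packet j vQ) → Prop)
      (frobLogvol : ℤ → ℤ → ∀ (j : (thetaIndexOfInitial T.D).Label) (vQ : (thetaIndexOfInitial T.D).VQ),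
        Set ((logShellsOfInitialDH T.D (analyticLogvVal T.K)).Packet j vQ) → ℝ)
      (frobΨ : ℤ → ℤ → ∀ v : (thetaIndexOfInitial T.D).V, v ∈ (thetaIndexOfInitial T.D).Vbad →
        Set ((logShellsOfInitialDH T.D (analyticLogvVal T.K)).StarPacket v))
      (frobMmod : ℤ → ℤ → ∀ j : (thetaIndexOfInitial T.D).LabelStar, Set ((logShellsOfInitialDH T.D (analyticLogvVal T.K)).GlobalPacket j.1))
      (unitImage : ℤ → ℤ → ℕ → ∀ (j : (thetaIndexOfInitial T.D).Label) (vQ : (thetaIndexOfInitial T.D).VQ),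
        Set ((logShellsOfInitialDH T.D (analyticLogvVal T.K)).Packet j vQ))
      (ballImage : ℤ → ℤ → ∀ (j : (thetaIndexOfInitial T.D).Label) (vQ : (thetaIndexOfInitial T.D).VQ),
        Set ((logShellsOfInitialDH T.D (analyticLogvVal T.K)).Packet j vQ))
      (thetaDiv : ℤ → ℤ → LgpDivisor M (thetaIndexOfInitial T.D).lstar)
      (n : ℤ) {HT : Type} {LogLink : HT → HT → Type} {IsFull : ∀ {s t : HT}, LogLink s t → Prop}
      (lat : LGPGaussianLogThetaLattice LogLink IsFull)
      {Frd : Type} {IsoF : Frd → Frd → Type} {Ob : Frd → Type} {realify : Frd → Frd} {Strip : Type}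
      {IsoS : Strip → Strip → Type} {Mv : ∀ v : (thetaIndexOfInitial T.D).V, v ∈ (thetaIndexOfInitial T.D).Vbad → Type}
      [∀ v h, Monoid (Mv v h)]
      (sig : GlobalLGPFrobenioidSignature (thetaIndexOfInitial T.D).lstar (thetaIndexOfInitial T.D).V
        (· ∈ (thetaIndexOfInitial T.D).Vbad) Frd IsoF Ob realify Strip IsoS Mv)
      (split : SplittingMonoids Mv) {ObΔ : Type} {N : ∀ v : (thetaIndexOfInitial T.D).V, v ∈ (thetaIndexOfInitial T.D).Vbad → Type}
      [∀ v h, Monoid (N v h)] (qData : QPilotData ObΔ N)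
      (qK : ∀ v : (thetaIndexOfInitial T.D).V, v ∈ (thetaIndexOfInitial T.D).Vbad →
        Set ((logShellsOfInitialDH T.D (analyticLogvVal T.K)).StarPacket v)),
      ¬ Cor312Vol.PilotKummerCompatHull
        (LatticeSituation.ofShells (logShellsOfInitialDH T.D (analyticLogvVal T.K)) M archPk archSub
          (summandPiecesPrM T.D (logvAnalyticVal_analyticLogvVal (K := T.K))).Adm (summandPiecesPrM T.D (logvAnalyticVal_analyticLogvVal (K := T.K))).logvol Ψ act Mmod region frobAdm frobLogvol
          frobΨ frobMmod unitImage ballImage thetaDiv)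
        (settingPrVolSharpM T.D (logvAnalyticVal_analyticLogvVal (K := T.K)) (tOfIdeleData T.D (ideleDataOf T.D T.isVolumeInputOf))
          (fun u x => tqM T.D (ratChar u) u (natCast_ratChar_mem u) (ideleDataOf T.D T.isVolumeInputOf) x) M archPk archSub Ψ act Mmod region n lat sig split qData
          (fun u x => tqM_ne_zero T.D (ratChar u) u (natCast_ratChar_mem u) (ideleDataOf T.D T.isVolumeInputOf) x)
          (GenuineM.finite_ratPlaces_under_S T.D).toFinset
          (fun u x hu => norm_tqM_eq_one_of_not_mem T.D (ratChar u) u (natCast_ratChar_mem u) (ideleDataOf T.D T.isVolumeInputOf) x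
            fun hx => hu ((Set.Finite.mem_toFinset _).mpr ⟨x, hx⟩)))
        (fun _ => Cor312.Setting.qRegion
          (settingPrVolSharpM T.D (logvAnalyticVal_analyticLogvVal (K := T.K)) (tOfIdeleData T.D (ideleDataOf T.D T.isVolumeInputOf))
          (fun u x => tqM T.D (ratChar u) u (natCast_ratChar_mem u) (ideleDataOf T.D T.isVolumeInputOf) x) M archPk archSub Ψ act Mmod region n lat sig split qData
          (fun u x => tqM_ne_zero T.D (ratChar u) u (natCast_ratChar_mem u) (ideleDataOf T.D T.isVolumeInputOf) x)
          (GenuineM.finite_ratPlaces_under_S T.D).toFinset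
          (fun u x hu => norm_tqM_eq_one_of_not_mem T.D (ratChar u) u (natCast_ratChar_mem u) (ideleDataOf T.D T.isVolumeInputOf) x
            fun hx => hu ((Set.Finite.mem_toFinset _).mpr ⟨x, hx⟩)))) qK :=
  GenuineM.not_pilotKummerCompatHull_triple_of_linUniform_table isABCTriple_frey10023806115968
    [(7, 19, 9, 1, 2), (13, 19, 9, 2, 5), (17, 19, 9, 2, 7), (23, 19, 9, 2, 9), (29, 19, 9, 2, 11), (31, 19, 9, 2, 11), (37, 19, 9, 2, 13),
      (41, 19, 9, 2, 15), (43, 19, 9, 2, 15), (47, 19, 9, 2, 17), (53, 19, 9, 2, 19), (59, 19, 9, 2, 21), (61, 19, 9, 2, 22), (67, 19, 9, 2, 24),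
      (71, 19, 9, 2, 25), (73, 19, 9, 2, 26), (79, 19, 9, 2, 28), (83, 19, 9, 2, 29), (89, 19, 9, 2, 31), (97, 19, 9, 2, 34), (101, 19, 9, 2, 35),
      (103, 19, 9, 2, 36), (107, 19, 9, 2, 37), (109, 19, 9, 2, 38), (113, 19, 9, 2, 39), (127, 19, 9, 2, 44), (131, 19, 9, 2, 45),
      (137, 19, 9, 2, 47), (139, 19, 9, 2, 48), (149, 19, 9, 2, 51), (151, 19, 9, 2, 52), (157, 19, 9, 2, 54), (163, 19, 9, 2, 56),
      (167, 19, 9, 2, 58), (173, 19, 9, 2, 60), (179, 19, 9, 2, 62), (181, 19, 9, 2, 62), (191, 19, 9, 2, 66), (193, 19, 9, 2, 66),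
      (197, 19, 9, 2, 68), (199, 19, 9, 2, 68), (211, 19, 9, 2, 73), (223, 19, 9, 3, 101), (227, 19, 9, 3, 103), (229, 19, 9, 3, 104),
      (233, 19, 9, 3, 106), (239, 19, 9, 3, 109), (241, 19, 9, 3, 109), (251, 19, 9, 3, 114), (257, 19, 9, 3, 117), (263, 19, 9, 3, 119),
      (269, 19, 9, 3, 122), (271, 19, 9, 3, 123), (277, 19, 9, 3, 126), (281, 19, 9, 3, 127), (283, 19, 9, 3, 128), (293, 19, 9, 3, 133),
      (307, 19, 9, 3, 139), (311, 19, 9, 3, 141), (313, 19, 9, 3, 142), (317, 19, 9, 3, 144), (331, 19, 9, 3, 150), (337, 19, 9, 3, 153),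
      (347, 19, 9, 3, 157), (349, 19, 9, 3, 158), (353, 19, 9, 3, 160), (359, 19, 9, 3, 163), (367, 19, 9, 3, 166), (373, 19, 9, 3, 169),
      (379, 19, 9, 3, 172), (383, 19, 9, 3, 173), (389, 19, 9, 3, 176), (397, 19, 9, 3, 180)]
    (by intro r hr; fin_cases hr <;> norm_num) (by simpa using hl) T u hu

/-- **M LINE, R-W N3 ROWS `frey-2^7*23^8+19^9*857^2=3^22*13*47^2*263` over `p = 23` — REFUTED side, UNCONDITIONALLY, by the local-type-uniform [LIN] test at the
1 Szpiro-bad admissible primes** `l ∈` {19} (rows of HOME/plan/rescue/R-W/TE30-CENSUS.tsv v2 with `linu_decidable = Y`; table rows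
`(l, p, v, B, i₀)`, j = i₀+1; `p = 23`, `v = 8` (all rows)): for every finite place `u` of `ℚ` with `p_u = 23` and every genuine Θ-volume datum `T` over `(ratPoint (a/c), l)`, the
hull-level clause S_H at the M-level sharp setting of `T`'s own read-off ideles (pinned reading) FAILS for every choice of the free context binders and Kummer
datum (M twin of the K-line `GenuineK.not_pilotKummerCompatHull_chosen_frey10023806115968_linu`). NOT claimed: admissibility / Szpiro-badness / (P6) / non-emptiness.
[cite: Mochizuki2012, IUTchIII Cor. 3.12 Step (xi-f) p. 184] [claim: Mochizuki2012, status: disputed] -/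
theorem GenuineM.not_pilotKummerCompatHull_frey10023806115968_p23_linu {l : ℕ}
    (hl : l ∈ [19])
    (T : Cor22.ThetaVolumeDatumAt (ratPoint (((2 ^ 7 * 23 ^ 8 : ℕ) : ℚ) / (3 ^ 22 * 13 * 47 ^ 2 * 263 : ℕ))) l) (u : FinitePlace ℚ) (hu : ratChar u = 23) :
    letI := T.instFieldF; letI := T.instNumberFieldF; letI := T.instAlgebraF; letI := T.instFieldK
    letI := T.instNumberFieldK; letI := T.instAlgebraK; letI := T.instFieldFbar; letI := T.instAlgebraFbar
    letI := T.instAlgebraKFbar; letI := T.instIsElliptic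
    ∀ (M : Type) [Field M] [NumberField M]
      (archPk : ∀ (j : (thetaIndexOfInitial T.D).Label) (vQ : (thetaIndexOfInitial T.D).VQ),
        Set ((logShellsOfInitialDH T.D (analyticLogvVal T.K)).Packet j vQ))
      (archSub : ∀ (j : (thetaIndexOfInitial T.D).Label) (v : (thetaIndexOfInitial T.D).V),
        Set ((logShellsOfInitialDH T.D (analyticLogvVal T.K)).Packet j ((thetaIndexOfInitial T.D).over v)))
      (Ψ : ℤ → ∀ v : (thetaIndexOfInitial T.D).V, v ∈ (thetaIndexOfInitial T.D).Vbad →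
        Set ((logShellsOfInitialDH T.D (analyticLogvVal T.K)).StarPacket v))
      (act : ℤ → ∀ v : (thetaIndexOfInitial T.D).V, v ∈ (thetaIndexOfInitial T.D).Vbad →
        (logShellsOfInitialDH T.D (analyticLogvVal T.K)).StarPacket v →
          Module.End ℚ ((logShellsOfInitialDH T.D (analyticLogvVal T.K)).StarPacket v))
      (Mmod : ℤ → ∀ j : (thetaIndexOfInitial T.D).LabelStar, Set ((logShellsOfInitialDH T.D (analyticLogvVal T.K)).GlobalPacket j.1))
      (region : ℤ → ∀ j : (thetaIndexOfInitial T.D).LabelStar, FinDivisor M → ∀ vQ : (thetaIndexOfInitial T.D).VQ,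
        Set ((logShellsOfInitialDH T.D (analyticLogvVal T.K)).Packet j.1 vQ))
      (frobAdm : ℤ → ℤ → ∀ (j : (thetaIndexOfInitial T.D).Label) (vQ : (thetaIndexOfInitial T.D).VQ),
        Set ((logShellsOfInitialDH T.D (analyticLogvVal T.K)).Packet j vQ) → Prop)
      (frobLogvol : ℤ → ℤ → ∀ (j : (thetaIndexOfInitial T.D).Label) (vQ : (thetaIndexOfInitial T.D).VQ),
        Set ((logShellsOfInitialDH T.D (analyticLogvVal T.K)).Packet j vQ) → ℝ)
      (frobΨ : ℤ → ℤ → ∀ v : (thetaIndexOfInitial T.D).V, v ∈ (thetaIndexOfInitial T.D).Vbad →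
        Set ((logShellsOfInitialDH T.D (analyticLogvVal T.K)).StarPacket v))
      (frobMmod : ℤ → ℤ → ∀ j : (thetaIndexOfInitial T.D).LabelStar, Set ((logShellsOfInitialDH T.D (analyticLogvVal T.K)).GlobalPacket j.1))
      (unitImage : ℤ → ℤ → ℕ → ∀ (j : (thetaIndexOfInitial T.D).Label) (vQ : (thetaIndexOfInitial T.D).VQ),
        Set ((logShellsOfInitialDH T.D (analyticLogvVal T.K)).Packet j vQ))
      (ballImage : ℤ → ℤ → ∀ (j : (thetaIndexOfInitial T.D).Label) (vQ : (thetaIndexOfInitial T.D).VQ),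
        Set ((logShellsOfInitialDH T.D (analyticLogvVal T.K)).Packet j vQ))
      (thetaDiv : ℤ → ℤ → LgpDivisor M (thetaIndexOfInitial T.D).lstar)
      (n : ℤ) {HT : Type} {LogLink : HT → HT → Type} {IsFull : ∀ {s t : HT}, LogLink s t → Prop}
      (lat : LGPGaussianLogThetaLattice LogLink IsFull)
      {Frd : Type} {IsoF : Frd → Frd → Type} {Ob : Frd → Type} {realify : Frd → Frd} {Strip : Type}
      {IsoS : Strip → Strip → Type} {Mv : ∀ v : (thetaIndexOfInitial T.D).V, v ∈ (thetaIndexOfInitial T.D).Vbad → Type}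
      [∀ v h, Monoid (Mv v h)]
      (sig : GlobalLGPFrobenioidSignature (thetaIndexOfInitial T.D).lstar (thetaIndexOfInitial T.D).V
        (· ∈ (thetaIndexOfInitial T.D).Vbad) Frd IsoF Ob realify Strip IsoS Mv)
      (split : SplittingMonoids Mv) {ObΔ : Type} {N : ∀ v : (thetaIndexOfInitial T.D).V, v ∈ (thetaIndexOfInitial T.D).Vbad → Type}
      [∀ v h, Monoid (N v h)] (qData : QPilotData ObΔ N)
      (qK : ∀ v : (thetaIndexOfInitial T.D).V, v ∈ (thetaIndexOfInitial T.D).Vbad →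
        Set ((logShellsOfInitialDH T.D (analyticLogvVal T.K)).StarPacket v)),
      ¬ Cor312Vol.PilotKummerCompatHull
        (LatticeSituation.ofShells (logShellsOfInitialDH T.D (analyticLogvVal T.K)) M archPk archSub
          (summandPiecesPrM T.D (logvAnalyticVal_analyticLogvVal (K := T.K))).Adm (summandPiecesPrM T.D (logvAnalyticVal_analyticLogvVal (K := T.K))).logvol Ψ act Mmod region frobAdm frobLogvol
          frobΨ frobMmod unitImage ballImage thetaDiv)
        (settingPrVolSharpM T.D (logvAnalyticVal_analyticLogvVal (K := T.K)) (tOfIdeleData T.D (ideleDataOf T.D T.isVolumeInputOf))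
          (fun u x => tqM T.D (ratChar u) u (natCast_ratChar_mem u) (ideleDataOf T.D T.isVolumeInputOf) x) M archPk archSub Ψ act Mmod region n lat sig split qData
          (fun u x => tqM_ne_zero T.D (ratChar u) u (natCast_ratChar_mem u) (ideleDataOf T.D T.isVolumeInputOf) x)
          (GenuineM.finite_ratPlaces_under_S T.D).toFinset
          (fun u x hu => norm_tqM_eq_one_of_not_mem T.D (ratChar u) u (natCast_ratChar_mem u) (ideleDataOf T.D T.isVolumeInputOf) x
            fun hx => hu ((Set.Finite.mem_toFinset _).mpr ⟨x, hx⟩)))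
        (fun _ => Cor312.Setting.qRegion
          (settingPrVolSharpM T.D (logvAnalyticVal_analyticLogvVal (K := T.K)) (tOfIdeleData T.D (ideleDataOf T.D T.isVolumeInputOf))
          (fun u x => tqM T.D (ratChar u) u (natCast_ratChar_mem u) (ideleDataOf T.D T.isVolumeInputOf) x) M archPk archSub Ψ act Mmod region n lat sig split qData
          (fun u x => tqM_ne_zero T.D (ratChar u) u (natCast_ratChar_mem u) (ideleDataOf T.D T.isVolumeInputOf) x)
          (GenuineM.finite_ratPlaces_under_S T.D).toFinset
          (fun u x hu => norm_tqM_eq_one_of_not_mem T.D (ratChar u) u (natCast_ratChar_mem u) (ideleDataOf T.D T.isVolumeInputOf) x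
            fun hx => hu ((Set.Finite.mem_toFinset _).mpr ⟨x, hx⟩)))) qK :=
  GenuineM.not_pilotKummerCompatHull_triple_of_linUniform_table isABCTriple_frey10023806115968
    [(19, 23, 8, 2, 8)]
    (by intro r hr; fin_cases hr; norm_num) (by simpa using hl) T u hu


end Summit.ABC.IUTFork.Conditional

end
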